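import Summits.QuantumFields.YangMills.Theorems.BalabanUVNodesRateCarriersOfRecord13CoPH
import Summits.QuantumFields.YangMills.Theorems.BalabanUVNodesN18KingModelU3Rung

/-!
# BalabanUVNodes ∕ N18 — KING's MULTI-SCALE `A = 0` MODEL IN THE RECORD's NODE-U3 BUNDLE SHAPE `u3OfRecord₁₃ θ (U3Objects₁₁.ofFixed C EA EB ℓ) k
# = ⟨C, Window θ.γ, θ.γ, …⟩`: the N18 (and N22) slots of the bundle of record INHABITED AT THE RECORD's WINDOW `Window θ.γ` ∕ radius `θ.γ` by
# King's actual (4.42) three-factor graphs with letters passing `U3Letters₁₁.Signs`; the generic Stage-13 `CoPH` home faces for readings pinned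
# to fixed-carrier objects; N18's statement-of-record SHAPE `S_N18 (RRec₁₃CoPH 𝔯)` inhabited by readings pinned to King's objects
# (Track A, DAG node N18 = NE5 `T4OutputRate.NE5 EA EB W κ θ C₅` :211; cluster K4 «SpineRates»; key K3⁷ `SpineGivenEndpointR13SepCoPH`)

Cell `pub-ymgap`, WIDTH SEAT `pub-ymgap-dag-n18-w3` (g0; director-ym №197 ∕ HUMAN RULING D-0149), plan g77 W-SEAT-START-LIST v3 §n18 ITEM 3 «NE5 at
the KING MODEL scales with the record's window `Window θ.γ` (rung; `…N18KingModelScales` p415038 currency)».  Filed `--kind proof --supports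
stmt-QuantumFields-20544 --as helper`.  THEOREMS ONLY: 0 `def`, 0 `sorry`, standard axioms; compositions of landed declarations BY NAME.

HONEST FRAMING.  A BC5-TYPE SATISFIABILITY WITNESS of the N18 slot SHAPE of the rate-carrier bundle of record — C. King's `A = 0` scalar MODEL
of the NE5 mechanism ([King1986] Prop. 3.9 (3.73) p. 665, (4.42)–(4.43) p. 675; published, proved, typed by the n18-a∕-b∕-e lineage) — placed at
the record's window and radius.  NOT Bałaban's covariant one-step outputs `E^{(j)}(X; g, U_k(V))` ((0.24)∕(2.13) of [Balaban1987RG1]); NOT the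
record's functionals (node00-def-W1's `functionalC`, START-LIST §n18 item 1); NE5 for Bałaban's outputs is NOT IN PRINT and NOT PROVED; N18 is NOT
discharged; K3⁷ OPEN and NOT claimed; no inhabitant of `IsDatumOfRecord₁₃CCoPH` claimed (K0⁷ OPEN); counts UNMOVED (typed 28∕28 · discharged 5∕27,
A 5∕28); one finite 𝕋⁴ programme at fixed ε — R4 closes only the conditional finite-𝕋⁴ rung `BalabanLadder.UV`; nothing continuum ∕ ℝ⁴ ∕ OS ∕
mass gap ∕ Clay.
THE POINT.  Layer B at ₁₃ (`…RateCarriersOfRecord13(+CoPH)`, dag-n22-e) types node U3's bundle OF RECORD at run length `k` as `u3OfRecord₁₃ θ u k :=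
⟨u.levelCarriers k, Window θ.γ, θ.γ, u.κ, u.EA k, u.EB k, u.θ₅, u.C₅, u.moduli, u.C₉, u.ω, u.cr, u.ρ⟩` — node U3's window and radius ARE the record's
`]0, θ.γ]`, `θ.γ` (the K3 v2 draft's `rrOfRecord` reads exactly this) — with the home face `s_N18_rRec₁₃CoPH_iff`.  The tree's King-model rungs
(`…N18KingModelU3Rung`, `…N18KingModelTorus`, `…N18KingModelScales`) conclude `NE5 EA EB W κ θ C₅` ∕ `N18At ⟨C, W, γ′, …⟩` at an ARBITRARY window
and radius; dag-n18-d's FIXED-CARRIER home faces `YMDAG.N18.HLayer.s_N18_rRec₁₁∕₁₂_of_ofFixed(_mono)` exist at Stages 11∕12 only (at the `CoPH` keys the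
N18 lineage moved to W1 reading-data pins, `YMDAG.N18.W1Reading.*_pin`).  THIS FILE:
* §1 FIXED OBJECTS IN THE ₁₃ BUNDLE (θ : `Stage13Params F N`, any gauge rank): `n18At_u3OfRecord₁₃_ofFixed_iff` (`Iff.rfl`),
  `n18At_u3OfRecord₁₃_ofFixed_of_n18At` (from ANY bundle `v` carrying `N18At` whose window ⊇ `]0, θ.γ]^ℕ`, radius `≥ θ.γ`, letters dominated
  — `N18AtByName.n18At_mono`), `n18At_u3OfRecord₁₃_ofFixed_of_forall_window` (WINDOW-BLIND producers fill the slot at EVERY record window),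
  `ne9_of_couplingBlind_of_moduli_nonneg`, `fadingMemory_moduli_of_nonneg` (the two signs `0 ≤ C₉`, `0 ≤ ω` suffice),
  `n22At_u3OfRecord₁₃_ofFixed_of_couplingBlind` (a coupling-blind `EA` carries the N22 slot WITH THE MODULI OF RECORD `C₉·ω^{k−i}`).
* §2 THE ₁₃-`CoPH` HOME FOR READINGS PINNED TO FIXED OBJECTS: `s_N18_rRec₁₃CoPH_of_ofFixed`, `s_N18_rRec₁₃CoPH_of_ofFixed_mono`,
  `s_N22_rRec₁₃CoPH_of_ofFixed_couplingBlind` (`forall_datumKey₁₃CoPH_of_forall_admissible` + `s_N18∕s_N22_rRec₁₃CoPH_iff`; the `Signs`-currency N22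
  twin is dag-n22-e's `YMDAG.N22.s_N22_rRec₁₃CoPH_of_ne9_fading`).
* §3 KING's MODEL AT THE RECORD's WINDOW (the rung): `n18At_kingModel_u3OfRecord₁₃` — `κ > 0`, `C₅ ≥ 0` (functions of `d, L, a, m², γ` ONLY;
  `…N18KingModelTorus.ne5_kingModel_threeFactor_torus` BY NAME) such that for King's ACTUAL (4.42) graphs on Bałaban's tori at creation scales
  `j = scale X ≥ 1`, EVERY Stage-13 tuple `θ` and EVERY run length `k`: `N18At (u3OfRecord₁₃ θ (ofFixed C EA (fun _ => EB) ⟨κ, L^{−γ∕2}, C₅, C₉, ω,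
  cr, ρ⟩) k)` (window `Window θ.γ`, radius `θ.γ` by `rfl`; ONE `θ₅ = L^{−γ∕2}` for all scales); `n22At_kingModel_u3OfRecord₁₃`;
  `n18At_threeFactorRates_lemma45_u3OfRecord₁₃` (the `…N18KingModelScales` p415038 currency LITERALLY: `θ₅ = L^{−γ}`, the outer (3.71) lines as
  binders, `W := Window θ.γ`); `s_N18_rRec₁₃CoPH_kingModel` (N18's statement-of-record SHAPE at the `CoPH` home inhabited by ANY Stage-13 rate
  reading whose U3 objects are King's fixed objects; the N22 side is §2's `s_N22_rRec₁₃CoPH_of_ofFixed_couplingBlind` verbatim).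
* §4 LETTERS: `kingModel_letters_signs(_minimal)` — for `γ > 0` the block `⟨κ, L^{−γ∕2}, C₅, C₉, ω, cr, ρ⟩` (`0 ≤ C₉`, `0 ≤ ω`, `0 ≤ cr`,
  `max(L^{−γ∕2}, ω) ≤ ρ < 1`) HAS `U3Letters₁₁.Signs`: the rung PASSES the displayed letter guards.  So (dag-n18-e evidence #5 §4, restated at the
  bundle of record) sign∕nondegeneracy guards on the LETTERS do not separate King's model from Bałaban's outputs in the N18 ∕ N22 slots; what
  does is a guard on the FUNCTIONALS — coupling-SENSITIVITY of `u.EA` over the record's boxes (dag-n18-w2's item 2) or the (D4) read-out tie ∕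
  the W1 pin — none of which King's coupling-blind model meets (`N18Coherence.representsA_const_of_couplingBlind`); (D4)∕N17 NOT modelled here.
NOT COVERED: the `j = 0` piece of (3.73); (2.20) rescaling; derivative ∕ Hölder lines; the tower reading `U3Tower₁₁.objects`; Bałaban's `E^{(j)}`.

Sources (TYPES and the model only): C. King, *The U(1) Higgs model. I. The continuum limit*, Commun. Math. Phys. **102** (1986) 649–677
[King1986] — Prop. 3.9 (3.73) p. 665, (4.42)–(4.43) p. 675, Prop. 3.8 (3.71) p. 664, Lemma 4.5 (4.38) p. 674; T. Bałaban, Commun. Math. Phys.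
**109** (1987) 249–301 [Balaban1987RG1] — (0.24)–(0.25) p. 257, Thm 1 p. 259 («contained in an interval ]0, γ]»: the window), (1.18)–(1.22)
pp. 263–264; **116** (1988) 1–22 [Balaban1988RG2Cluster] (2.13)–(2.14) pp. 14–15.  No claim about the mass gap.
-/

noncomputable section

namespace Summit.QuantumFields.YangMills.BalabanUVNodes.N18KingModelRecordWindow

open Matrix
open Literature.MathematicalPhysics.QuantumFieldTheory.Balaban1983to89
open Literature.MathematicalPhysics.QuantumFieldTheory.Balaban1983to89.T4Continuum (T4Family ULoop)
open Literature.MathematicalPhysics.QuantumFieldTheory.Balaban1983to89.T4OutputRate (Carriers Functional NE5 NE9 FadingMemory Window)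
open Literature.MathematicalPhysics.QuantumFieldTheory.Balaban1983to89.B5Prop11Plancherel (Tor fine)
open Literature.MathematicalPhysics.QuantumFieldTheory.Balaban1983to89.B4Sect5Proof (latticeConst)
open Literature.MathematicalPhysics.QuantumFieldTheory.King1986 (aK)
open Literature.MathematicalPhysics.QuantumFieldTheory.King1986.Torus (minimiser effLaplacian blockProj blockOf tdistT K45 gam0L delta45)
open Node00 (Stage13Params Stage13HParams U3Letters₁₁ U3Objects₁₁ IsDatumOfRecord₁₃CCoPH datumOfRecord₁₃CoPH)
open Summit.QuantumFields.YangMills.BalabanUVNodes.N18KingModel (kingTheta_pos kingTheta_lt_one)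
open Summit.QuantumFields.YangMills.BalabanUVNodes.N18KingModelScales (ne5_of_threeFactorRates_lemma45)
open Summit.QuantumFields.YangMills.BalabanUVNodes.N18KingModelTorus (ne5_kingModel_threeFactor_torus)
open Summit.QuantumFields.YangMills.BalabanUVNodes.N18AtByName (n18At_mono)
open YMDAG.UVSplit

variable {N : ℕ} [NeZero N]

/-! ## §1 Fixed-carrier objects in the Stage-13 bundle of record: the N18 and N22 slots -/

section Fixed

variable {F : T4Family} (θ : Stage13Params F N) (C : Carriers) (EA : Functional C C.BgA) (EB : ℝ → Functional C C.BgB)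
  (ℓ : U3Letters₁₁) (k : ℕ)

/-- **WHAT THE N18 SLOT SAYS AT THE ₁₃ BUNDLE OF FIXED-CARRIER OBJECTS** (`Iff.rfl`): at every run length `k`, for every member
`b ∈ ]0, θ.γ]` of run B's first-coupling family, the two-run η-rate `NE5 EA (EB b) (Window θ.γ) ℓ.κ ℓ.θ₅ ℓ.C₅` — ON THE RECORD's WINDOW
`]0, θ.γ]^ℕ`, i.e. `|EA g (transport U) X − EB b g U X| ≤ ℓ.C₅ · ℓ.θ₅ ^ scale X · e^{−ℓ.κ·d X}` for `g ∈ ]0, θ.γ]^ℕ`.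
[cite: Balaban1987RG1, Thm 1 p.259 and (1.18) p.263] -/
theorem n18At_u3OfRecord₁₃_ofFixed_iff :
    N18At (u3OfRecord₁₃ θ (U3Objects₁₁.ofFixed C EA EB ℓ) k) ↔
      ∀ b : ℝ, 0 < b → b ≤ θ.γ → NE5 EA (EB b) (Window θ.γ) ℓ.κ ℓ.θ₅ ℓ.C₅ :=
  Iff.rfl

variable {θ C EA EB ℓ}

/-- **THE RECORD's LETTERS NEED ONLY DOMINATE A PRODUCER's**: `N18At` at ANY bundle `v` whose carriers and functionals are the fixed
objects', whose window CONTAINS the record's `]0, θ.γ]^ℕ` with radius `≥ θ.γ`, and whose letters the block `ℓ` dominates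
(`ℓ.κ ≤ v.κ`, `0 ≤ v.θ ≤ ℓ.θ₅`, `0 ≤ v.C₅ ≤ ℓ.C₅`; NE9 ∕ read-out letters unread) gives the N18 slot at EVERY run length of the ₁₃ bundle
(`N18AtByName.n18At_mono`). [cite: Balaban1987RG1, Thm 1 p.259] -/
theorem n18At_u3OfRecord₁₃_ofFixed_of_n18At {W : Set (ℕ → ℝ)} {γ' κ' θ' C₅' : ℝ} {Λ : ℕ → ℕ → ℝ} {C₉ ω cr ρ : ℝ}
    (h : N18At ⟨C, W, γ', κ', EA, EB, θ', C₅', Λ, C₉, ω, cr, ρ⟩) (hW : Window θ.γ ⊆ W) (hγ : θ.γ ≤ γ') (hκ : ℓ.κ ≤ κ')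
    (hθ0 : 0 ≤ θ') (hθ : θ' ≤ ℓ.θ₅) (hC0 : 0 ≤ C₅') (hC : C₅' ≤ ℓ.C₅) :
    N18At (u3OfRecord₁₃ θ (U3Objects₁₁.ofFixed C EA EB ℓ) k) :=
  n18At_mono h hW hγ hκ hθ0 hθ hC0 hC

/-- **WINDOW-BLIND PRODUCERS FILL THE N18 SLOT AT EVERY RECORD WINDOW**: if `NE5 EA (EB b) W ℓ.κ ℓ.θ₅ ℓ.C₅` holds on EVERY window `W`
for every member `b > 0` (King's model; any END stated «for every window»), then the N18 slot of the ₁₃ bundle of the fixed objects holds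
at EVERY Stage-13 tuple `θ` and EVERY run length `k` — the record's `Window θ.γ` is one window. [cite: Balaban1987RG1, Thm 1 p.259] -/
theorem n18At_u3OfRecord₁₃_ofFixed_of_forall_window
    (h : ∀ (W : Set (ℕ → ℝ)) (b : ℝ), 0 < b → NE5 EA (EB b) W ℓ.κ ℓ.θ₅ ℓ.C₅) (θ : Stage13Params F N) (k : ℕ) :
    N18At (u3OfRecord₁₃ θ (U3Objects₁₁.ofFixed C EA EB ℓ) k) :=
  fun b hb _ => h (Window θ.γ) b hb

/-- **NE9 FOR A COUPLING-BLIND FUNCTIONAL WITH ANY NONNEGATIVE MODULI**: if run A's functional does not read the coupling sequence,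
`NE9 EA W κ Λ` holds on every window for every moduli family nonnegative below the creation scale (the left side vanishes) — the
moduli OF RECORD `C₉·ω^{k−i}` included (`N18Coherence.ne9_zero_of_couplingBlind` is the zero-moduli case).
[cite: Balaban1987RG1, §1 p.263 and §5 p.298] -/
theorem ne9_of_couplingBlind_of_moduli_nonneg {Bg : Type} {E : Functional C Bg}
    (hE : ∀ (g g' : ℕ → ℝ) (U : Bg) (X : C.Dom), E g U X = E g' U X) (W : Set (ℕ → ℝ)) (κ : ℝ) {Λ : ℕ → ℕ → ℝ}
    (hΛ : ∀ j i, i < j → 0 ≤ Λ j i) : NE9 E W κ Λ := by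
  intro g _ g' _ U X
  rw [hE g g' U X, sub_self, abs_zero]
  refine mul_nonneg (Real.exp_pos _).le (Finset.sum_nonneg fun i hi => ?_)
  exact mul_nonneg (hΛ _ _ (Finset.mem_range.mp hi)) (abs_nonneg _)

/-- **`FadingMemory` FOR THE MODULI OF RECORD FROM THE TWO SIGNS** `0 ≤ C₉`, `0 ≤ ω` (no estimate: `ℓ.moduli k i = C₉·ω^{k−i}` by
construction; layer B's `fadingMemory_u3OfRecord₁₃` asks the full `Signs`). [cite: Balaban1988RG2Cluster, (2.13) p.14 and (2.14) p.15] -/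
theorem fadingMemory_moduli_of_nonneg (ℓ : U3Letters₁₁) (hC₉ : 0 ≤ ℓ.C₉) (hω : 0 ≤ ℓ.ω) :
    FadingMemory ℓ.C₉ ℓ.ω ℓ.moduli :=
  fun k i _ => ⟨mul_nonneg hC₉ (pow_nonneg hω (k - i)), le_rfl⟩

/-- **A COUPLING-BLIND RUN A CARRIES THE N22 SLOT OF THE ₁₃ BUNDLE WITH THE MODULI OF RECORD** (`C₉·ω^{k−i}`, signs `0 ≤ C₉`, `0 ≤ ω`),
at EVERY Stage-13 tuple and run length: NE9 vanishes on the left, fading memory is the letter-sign face.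
[cite: Balaban1987RG1, §1 p.263 and §5 p.298; Balaban1988RG2Cluster, (2.13)-(2.14) pp.14-15] -/
theorem n22At_u3OfRecord₁₃_ofFixed_of_couplingBlind
    (hE : ∀ (g g' : ℕ → ℝ) (U : C.BgA) (X : C.Dom), EA g U X = EA g' U X) (hC₉ : 0 ≤ ℓ.C₉) (hω : 0 ≤ ℓ.ω)
    (θ : Stage13Params F N) (k : ℕ) :
    N22At (u3OfRecord₁₃ θ (U3Objects₁₁.ofFixed C EA EB ℓ) k) :=
  ⟨ne9_of_couplingBlind_of_moduli_nonneg hE (Window θ.γ) ℓ.κ fun j i _ => mul_nonneg hC₉ (pow_nonneg hω (j - i)),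
    fadingMemory_moduli_of_nonneg ℓ hC₉ hω⟩

end Fixed

/-! ## §2 The Stage-13 `CoPH` home for a reading pinned to fixed-carrier objects -/

section Home

variable (𝔯 : RateReading₁₃CoPH N)

/-- **FIXED CARRIERS AT THE ₁₃-`CoPH` HOME** (dag-n18-d's `s_N18_rRec₁₁∕₁₂_of_ofFixed` at the Stage-13 `CoPH` keys): if at every admissible
Stage-13 tuple `θ` with provisos and every `(g₀, os)` the reading's U3 objects ARE the fixed bundle `U3Objects₁₁.ofFixed C EA EB ℓ` of one
pair-carrier structure with, member by member `b ∈ ]0, θ.γ]`, `NE5 EA (EB b) (Window θ.γ) ℓ.κ ℓ.θ₅ ℓ.C₅` ON THE RECORD's WINDOW, then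
`S_N18 (RRec₁₃CoPH 𝔯)` (`forall_datumKey₁₃CoPH_of_forall_admissible` + `s_N18_rRec₁₃CoPH_iff`; the level `k` drops out for fixed objects).
[cite: Balaban1987RG1, Thm 1 p.259 and (1.18) p.263] -/
theorem s_N18_rRec₁₃CoPH_of_ofFixed
    (h : ∀ (F : T4Family) (θ : Stage13HParams F N) (hP : θ.Provisos₁₃CoPH F N), θ.Admissible F N →
      ∀ (g₀ : ℕ → ℝ) (os : List (ULoop F)),
        ∃ (C : Carriers) (EA : Functional C C.BgA) (EB : ℝ → Functional C C.BgB) (ℓ : U3Letters₁₁),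
          (𝔯.lit F θ hP g₀ os).u3 = U3Objects₁₁.ofFixed C EA EB ℓ ∧
          ∀ b : ℝ, 0 < b → b ≤ θ.γ → NE5 EA (EB b) (Window θ.γ) ℓ.κ ℓ.θ₅ ℓ.C₅) :
    S_N18 (RRec₁₃CoPH 𝔯) := by
  refine (s_N18_rRec₁₃CoPH_iff 𝔯).2 fun F D hk g₀ os k => ?_
  refine forall_datumKey₁₃CoPH_of_forall_admissible
    (P := fun F _ θ hP g₀ os k => N18At (u3OfRecord₁₃ θ.toStage13Params (𝔯.lit F θ hP g₀ os).u3 k)) ?_ F D hk g₀ os k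
  intro F θ hP hA g₀ os k
  obtain ⟨C, EA, EB, ℓ, hu, hN⟩ := h F θ hP hA g₀ os
  show N18At (u3OfRecord₁₃ θ.toStage13Params (𝔯.lit F θ hP g₀ os).u3 k)
  rw [hu]
  exact (n18At_u3OfRecord₁₃_ofFixed_iff θ.toStage13Params C EA EB ℓ k).2 hN

/-- **FIXED CARRIERS AT THE ₁₃-`CoPH` HOME, THE RECORD's LETTERS DOMINATING A PRODUCER's** (the `_mono` face at the `CoPH` keys): if at every
admissible tuple with provisos and every `(g₀, os)` the reading's U3 objects ARE `U3Objects₁₁.ofFixed v.C v.EA v.EB ℓ` for SOME bundle `v`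
with `N18At v`, `Window θ.γ ⊆ v.W`, `θ.γ ≤ v.γ`, `ℓ.κ ≤ v.κ`, `0 ≤ v.θ ≤ ℓ.θ₅`, `0 ≤ v.C₅ ≤ ℓ.C₅`, then `S_N18 (RRec₁₃CoPH 𝔯)`.
[cite: Balaban1987RG1, Thm 1 p.259 and (1.18) p.263] -/
theorem s_N18_rRec₁₃CoPH_of_ofFixed_mono
    (h : ∀ (F : T4Family) (θ : Stage13HParams F N) (hP : θ.Provisos₁₃CoPH F N), θ.Admissible F N →
      ∀ (g₀ : ℕ → ℝ) (os : List (ULoop F)),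
        ∃ (v : U3Carriers) (ℓ : U3Letters₁₁),
          (𝔯.lit F θ hP g₀ os).u3 = U3Objects₁₁.ofFixed v.C v.EA v.EB ℓ ∧ N18At v ∧
          Window θ.γ ⊆ v.W ∧ θ.γ ≤ v.γ ∧ ℓ.κ ≤ v.κ ∧ 0 ≤ v.θ ∧ v.θ ≤ ℓ.θ₅ ∧ 0 ≤ v.C₅ ∧ v.C₅ ≤ ℓ.C₅) :
    S_N18 (RRec₁₃CoPH 𝔯) := by
  refine s_N18_rRec₁₃CoPH_of_ofFixed 𝔯 fun F θ hP hA g₀ os => ?_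
  obtain ⟨v, ℓ, hu, hv, hW, hγ, hκ, hθ0, hθ, hC0, hC⟩ := h F θ hP hA g₀ os
  obtain ⟨C, W, γv, κv, EAv, EBv, θv, C₅v, Λv, C₉v, ωv, crv, ρv⟩ := v
  refine ⟨C, EAv, EBv, ℓ, hu, ?_⟩
  exact (n18At_u3OfRecord₁₃_ofFixed_iff θ.toStage13Params C EAv EBv ℓ 0).1
    (n18At_u3OfRecord₁₃_ofFixed_of_n18At (θ := θ.toStage13Params) (k := 0) hv hW hγ hκ hθ0 hθ hC0 hC)

/-- **COUPLING-BLIND FIXED CARRIERS AT THE ₁₃-`CoPH` HOME, N22 SIDE**: if at every admissible tuple with provisos and every `(g₀, os)` the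
reading's U3 objects ARE `U3Objects₁₁.ofFixed C EA EB ℓ` with run A's `EA` COUPLING-BLIND and signs `0 ≤ ℓ.C₉`, `0 ≤ ℓ.ω`, then
`S_N22 (RRec₁₃CoPH 𝔯)` — NE9 vanishes, fading memory of the moduli of record is the sign face (`s_N22_rRec₁₃CoPH_iff`).
[cite: Balaban1987RG1, §1 p.263 and §5 p.298] -/
theorem s_N22_rRec₁₃CoPH_of_ofFixed_couplingBlind
    (h : ∀ (F : T4Family) (θ : Stage13HParams F N) (hP : θ.Provisos₁₃CoPH F N), θ.Admissible F N →
      ∀ (g₀ : ℕ → ℝ) (os : List (ULoop F)),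
        ∃ (C : Carriers) (EA : Functional C C.BgA) (EB : ℝ → Functional C C.BgB) (ℓ : U3Letters₁₁),
          (𝔯.lit F θ hP g₀ os).u3 = U3Objects₁₁.ofFixed C EA EB ℓ ∧
          (∀ (g g' : ℕ → ℝ) (U : C.BgA) (X : C.Dom), EA g U X = EA g' U X) ∧ 0 ≤ ℓ.C₉ ∧ 0 ≤ ℓ.ω) :
    S_N22 (RRec₁₃CoPH 𝔯) := by
  refine (s_N22_rRec₁₃CoPH_iff 𝔯).2 fun F D hk g₀ os k => ?_
  refine forall_datumKey₁₃CoPH_of_forall_admissible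
    (P := fun F _ θ hP g₀ os k => N22At (u3OfRecord₁₃ θ.toStage13Params (𝔯.lit F θ hP g₀ os).u3 k)) ?_ F D hk g₀ os k
  intro F θ hP hA g₀ os k
  obtain ⟨C, EA, EB, ℓ, hu, hE, hC₉, hω⟩ := h F θ hP hA g₀ os
  show N22At (u3OfRecord₁₃ θ.toStage13Params (𝔯.lit F θ hP g₀ os).u3 k)
  rw [hu]
  exact n22At_u3OfRecord₁₃_ofFixed_of_couplingBlind hE hC₉ hω θ.toStage13Params k

end Home

/-! ## §3 KING's MODEL AT THE RECORD's WINDOW — the rung in the bundle-of-record shape -/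

section King

variable {d : ℕ}

/-- **KING's (3.73) ∕ (4.42) THREE-FACTOR MODEL INHABITS THE N18 SLOT OF THE ₁₃ BUNDLE AT EVERY STAGE-13 TUPLE AND RUN LENGTH.**  For
`d ≥ 1`, odd `L > 1`, `a > 0`, `m² > 0`, `0 ≤ γ ≤ 1` there are `κ > 0`, `C₅ ≥ 0` — functions of `d, L, a, m², γ` ONLY, the letters of
`…N18KingModelTorus.ne5_kingModel_threeFactor_torus` (n18-a g4, BY NAME) — such that for EVERY `n ≥ 1`, every scale-indexed family of
Bałaban unit tori `L·M_j(μ) = 2L^{m_j}`, every carriers `C` with creation scales `j = scale X ≥ 1` reading run A's fine points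
`x_A(X), y_A(X)` (`L^j` per unit side) UNDER run B's `x_B(X), y_B(X)` (`L^nL^j`) with `d X ≤ |B(x_A) − B(y_A)|_{T₁}`, every functionals
reading King's ACTUAL (4.42) graphs `EA g U X = Σ_{z,w} ℋ_j(x_A,z)·C^{(j)}(z,w)·ℋ_j(y_A,w)`, `EB g U X = Σ ℋ_{j+n}(x_B,z)·C^{(j+n)}(z,w)·
ℋ_{j+n}(y_B,w)` (`ℋ = minimiser`, `C^{(·)} = (effLaplacian + aL⁻²·blockProj)⁻¹`), EVERY gauge rank, EVERY Stage-13 tuple `θ` (window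
`]0, θ.γ]`, radius `θ.γ`), EVERY run length `k` and ANY remaining letters `C₉, ω, cr, ρ`:
`N18At (u3OfRecord₁₃ θ (ofFixed C EA (fun _ => EB) ⟨κ, L^{−γ∕2}, C₅, C₉, ω, cr, ρ⟩) k)`.  ONE `θ₅ = L^{−γ∕2}` for ALL scales, `< 1` iff
`γ > 0`.  `A = 0` MODEL: `g`, `U`, `b` unread; NOT Bałaban's outputs; NOT the record's `functionalC`.
[cite: King1986, Prop. 3.9 (3.73) p.665 and (4.42)-(4.43) p.675; Balaban1987RG1, Thm 1 p.259] -/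
theorem n18At_kingModel_u3OfRecord₁₃ (hd : 1 ≤ d) (L : ℕ) [NeZero L] (hLp : Odd L ∧ 1 < L) {a m2 : ℝ}
    (ha : 0 < a) (hm : 0 < m2) {γ : ℝ} (hγ0 : 0 ≤ γ) (hγ1 : γ ≤ 1) :
    ∃ κ C₅ : ℝ, 0 < κ ∧ 0 ≤ C₅ ∧
      ∀ (n : ℕ) (_hn : 1 ≤ n) (M : ℕ → Fin d → ℕ) [∀ j μ, NeZero (M j μ)]
        (_hM : ∀ j, ∃ mm : ℕ, ∀ μ, L * M j μ = 2 * L ^ mm)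
        (C : Carriers) (_hsc : ∀ X, 1 ≤ C.scale X)
        (xA yA : (X : C.Dom) → Tor (fine (L ^ C.scale X) (fine L (M (C.scale X)))))
        (xB yB : (X : C.Dom) → Tor (fine (L ^ n * L ^ C.scale X) (fine L (M (C.scale X)))))
        (_hx : ∀ X μ, (xA X μ).val = (xB X μ).val / L ^ n)
        (_hy : ∀ X μ, (yA X μ).val = (yB X μ).val / L ^ n)
        (_hd : ∀ X, C.d X ≤ tdistT (fine L (M (C.scale X)))
            (blockOf (L ^ C.scale X) (fine L (M (C.scale X))) (xA X))
            (blockOf (L ^ C.scale X) (fine L (M (C.scale X))) (yA X)))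
        (EA : Functional C C.BgA) (EB : Functional C C.BgB)
        (_hEA : ∀ g U X, EA g U X =
          (fun z => minimiser (L ^ C.scale X) (fine L (M (C.scale X))) (aK a L (C.scale X))
              (((L ^ C.scale X : ℕ) : ℝ) ^ 2) m2 (Pi.single z 1) (xA X))
            ⬝ᵥ ((effLaplacian (L ^ C.scale X) (fine L (M (C.scale X))) (aK a L (C.scale X))
                    (((L ^ C.scale X : ℕ) : ℝ) ^ 2) m2
                  + (a * ((L : ℝ) ^ 2)⁻¹) • blockProj L (M (C.scale X)))⁻¹
                *ᵥ fun w => minimiser (L ^ C.scale X) (fine L (M (C.scale X))) (aK a L (C.scale X))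
                    (((L ^ C.scale X : ℕ) : ℝ) ^ 2) m2 (Pi.single w 1) (yA X)))
        (_hEB : ∀ g U X, EB g U X =
          (fun z => minimiser (L ^ n * L ^ C.scale X) (fine L (M (C.scale X))) (aK a L (C.scale X + n))
              (((L ^ n * L ^ C.scale X : ℕ) : ℝ) ^ 2) m2 (Pi.single z 1) (xB X))
            ⬝ᵥ ((effLaplacian (L ^ n * L ^ C.scale X) (fine L (M (C.scale X))) (aK a L (C.scale X + n))
                    (((L ^ n * L ^ C.scale X : ℕ) : ℝ) ^ 2) m2
                  + (a * ((L : ℝ) ^ 2)⁻¹) • blockProj L (M (C.scale X)))⁻¹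
                *ᵥ fun w => minimiser (L ^ n * L ^ C.scale X) (fine L (M (C.scale X))) (aK a L (C.scale X + n))
                    (((L ^ n * L ^ C.scale X : ℕ) : ℝ) ^ 2) m2 (Pi.single w 1) (yB X)))
        {N : ℕ} [NeZero N] {F : T4Family} (θ : Stage13Params F N) (k : ℕ) (C₉ ω cr ρ : ℝ),
        N18At (u3OfRecord₁₃ θ
          (U3Objects₁₁.ofFixed C EA (fun _ => EB) ⟨κ, (L : ℝ) ^ (-(γ / 2)), C₅, C₉, ω, cr, ρ⟩) k) := by
  obtain ⟨κ, C₅, hκ, hC₅, H⟩ := ne5_kingModel_threeFactor_torus hd L hLp ha hm hγ0 hγ1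
  refine ⟨κ, C₅, hκ, hC₅, ?_⟩
  intro n hn M _ hM C hsc xA yA xB yB hx hy hdd EA EB hEA hEB N _ F θ k C₉ ω cr ρ
  exact n18At_u3OfRecord₁₃_ofFixed_of_forall_window (C := C) (EA := EA) (EB := fun _ => EB)
    (ℓ := ⟨κ, (L : ℝ) ^ (-(γ / 2)), C₅, C₉, ω, cr, ρ⟩)
    (fun W _ _ => H n hn M hM C hsc xA yA xB yB hx hy hdd EA EB hEA hEB W) θ k

/-- **… AND THE N22 SLOT** (run A COUPLING-BLIND — King's `EA g U X` reads neither `g` nor `U`; signs `0 ≤ C₉`, `0 ≤ ω`): at EVERY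
Stage-13 tuple and run length, `N22At (u3OfRecord₁₃ θ (ofFixed C EA (fun _ => EB) ⟨κ, θ₅, C₅, C₉, ω, cr, ρ⟩) k)` with the moduli OF RECORD
`C₉·ω^{k−i}` — NE9 vanishes (no running coupling), fading memory is the sign face; ANY `κ, θ₅, C₅, cr, ρ`.
[cite: Balaban1987RG1, §1 p.263 and §5 p.298] -/
theorem n22At_kingModel_u3OfRecord₁₃ {C : Carriers} {EA : Functional C C.BgA} {EB : Functional C C.BgB}
    (hg : ∀ (g g' : ℕ → ℝ) (U : C.BgA) (X : C.Dom), EA g U X = EA g' U X) {N : ℕ} [NeZero N] {F : T4Family}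
    (θ : Stage13Params F N) (k : ℕ) (κ θ₅ C₅ : ℝ) {C₉ ω : ℝ} (hC₉ : 0 ≤ C₉) (hω : 0 ≤ ω) (cr ρ : ℝ) :
    N22At (u3OfRecord₁₃ θ (U3Objects₁₁.ofFixed C EA (fun _ => EB) ⟨κ, θ₅, C₅, C₉, ω, cr, ρ⟩) k) :=
  n22At_u3OfRecord₁₃_ofFixed_of_couplingBlind (ℓ := ⟨κ, θ₅, C₅, C₉, ω, cr, ρ⟩) hg hC₉ hω θ k

/-- **THE `…N18KingModelScales` (p415038) CURRENCY LITERALLY, AT THE RECORD's WINDOW**: (3.73)'s assembly on the scale-`j` tori with the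
MIDDLE line discharged by name (`king_cov_decay_torus`, `king_lemma45_torus`, `tdistT_sumBound`) and ONLY the outer (3.71) lines as binders
(sizes `sA, sB`, rates `cA·(L^{−γ})^j`, `cB·(L^{−γ})^j`, decay `0 < κ ≤ δ₄₅`) — `N18KingModelScales.ne5_of_threeFactorRates_lemma45` at
`W := Window θ.γ` — gives the N18 slot of the ₁₃ bundle at EVERY Stage-13 tuple and run length with rate `θ₅ = L^{−γ}` (`< 1` iff `γ > 0`),
decay `κ∕2` and the scale-uniform constant `((cA·(2∕γ₀)·sB + sA·K₄₅·sB + sA·(2∕γ₀)·cB)·K_d(κ∕2)²)`.  `A = 0` MODEL.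
[cite: King1986, Prop. 3.9 (3.73) p.665, (4.42)-(4.43) p.675 and Lemma 4.5 (4.38) p.674] -/
theorem n18At_threeFactorRates_lemma45_u3OfRecord₁₃ (L : ℕ) [NeZero L] (hL : 2 ≤ L) {a m2 : ℝ} (ha : 0 < a) (hm : 0 < m2)
    {n : ℕ} (hn : 1 ≤ n) (M : ℕ → Fin d → ℕ) [∀ j μ, NeZero (M j μ)] {γ : ℝ} (hγ1 : γ ≤ 1)
    {C : Carriers} (hsc : ∀ X : C.Dom, 1 ≤ C.scale X)
    (p r : (X : C.Dom) → Tor (fine L (M (C.scale X))))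
    (uA uB vA vB : (X : C.Dom) → Tor (fine L (M (C.scale X))) → ℝ)
    (CA CB : (X : C.Dom) → Matrix (Tor (fine L (M (C.scale X)))) (Tor (fine L (M (C.scale X)))) ℝ)
    (hCAdef : ∀ X, CA X = (effLaplacian (L ^ C.scale X) (fine L (M (C.scale X))) (aK a L (C.scale X))
          (((L ^ C.scale X : ℕ) : ℝ) ^ 2) m2 + (a * ((L : ℝ) ^ 2)⁻¹) • blockProj L (M (C.scale X)))⁻¹)
    (hCBdef : ∀ X, CB X = (effLaplacian (L ^ n * L ^ C.scale X) (fine L (M (C.scale X))) (aK a L (C.scale X + n))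
          (((L ^ n * L ^ C.scale X : ℕ) : ℝ) ^ 2) m2 + (a * ((L : ℝ) ^ 2)⁻¹) • blockProj L (M (C.scale X)))⁻¹)
    {κ sA sB cA cB : ℝ} (hκ : 0 < κ) (hκδ : κ ≤ delta45 d a L) (hsA : 0 ≤ sA) (hsB : 0 ≤ sB)
    (hcA : 0 ≤ cA) (hcB : 0 ≤ cB)
    (hu : ∀ X z, |uA X z| ≤ sA * Real.exp (-(κ * tdistT _ (p X) z)))
    (hv : ∀ X w, |vB X w| ≤ sB * Real.exp (-(κ * tdistT _ w (r X))))
    (hdu : ∀ X z, |uB X z - uA X z| ≤ cA * ((L : ℝ) ^ (-γ)) ^ C.scale X * Real.exp (-(κ * tdistT _ (p X) z)))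
    (hdv : ∀ X w, |vB X w - vA X w| ≤ cB * ((L : ℝ) ^ (-γ)) ^ C.scale X * Real.exp (-(κ * tdistT _ w (r X))))
    (hd : ∀ X, C.d X ≤ tdistT _ (p X) (r X))
    {EA : Functional C C.BgA} {EB : Functional C C.BgB}
    (hEA : ∀ g U X, EA g U X = uA X ⬝ᵥ (CA X *ᵥ vA X))
    (hEB : ∀ g U X, EB g U X = uB X ⬝ᵥ (CB X *ᵥ vB X))
    {N : ℕ} [NeZero N] {F : T4Family} (θ : Stage13Params F N) (k : ℕ) (C₉ ω cr ρ : ℝ) :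
    N18At (u3OfRecord₁₃ θ
      (U3Objects₁₁.ofFixed C EA (fun _ => EB)
        ⟨κ / 2, (L : ℝ) ^ (-γ),
          (cA * (2 / gam0L d a L) * sB + sA * K45 d a L * sB + sA * (2 / gam0L d a L) * cB) * (latticeConst d (κ / 2)) ^ 2,
          C₉, ω, cr, ρ⟩) k) :=
  fun _ _ _ => ne5_of_threeFactorRates_lemma45 (W := Window θ.γ) L hL ha hm hn M hγ1 hsc p r uA uB vA vB CA CB hCAdef hCBdef
    hκ hκδ hsA hsB hcA hcB hu hv hdu hdv hd hEA hEB

/-- **N18's STATEMENT-OF-RECORD SHAPE AT THE ₁₃-`CoPH` HOME INHABITED BY KING's MODEL.**  With the letters `κ > 0`, `C₅ ≥ 0` of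
`n18At_kingModel_u3OfRecord₁₃` (functions of `d, L, a, m², γ` only): ANY Stage-13 rate reading `𝔯` (any gauge rank) whose node-U3
objects at every admissible tuple with provisos and every `(g₀, os)` ARE King's fixed objects `ofFixed C EA (fun _ => EB) ⟨κ, L^{−γ∕2}, C₅,
C₉, ω, cr, ρ⟩` for SOME King data as in `n18At_kingModel_u3OfRecord₁₃` (`n`, torus family, carriers, fine points, read-out formulas;
the remaining letters free) satisfies `S_N18 (RRec₁₃CoPH 𝔯)`.  A SATISFIABILITY WITNESS of the home's N18 face (BC5-type): the shape is
met with HONEST letters (`κ > 0`, `0 < θ₅ < 1` for `γ > 0`) by a coupling- and background-BLIND model — so the face alone does not tie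
`𝔯`'s functionals to Bałaban's run (dag-n18-e evidence #5 §4; the tie is the W1 pin ∕ (D4)); NOT N18's discharge.
[cite: King1986, Prop. 3.9 (3.73) p.665 and (4.42)-(4.43) p.675; Balaban1987RG1, Thm 1 p.259 and (1.18) p.263] -/
theorem s_N18_rRec₁₃CoPH_kingModel (hd : 1 ≤ d) (L : ℕ) [NeZero L] (hLp : Odd L ∧ 1 < L) {a m2 : ℝ}
    (ha : 0 < a) (hm : 0 < m2) {γ : ℝ} (hγ0 : 0 ≤ γ) (hγ1 : γ ≤ 1) :
    ∃ κ C₅ : ℝ, 0 < κ ∧ 0 ≤ C₅ ∧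
      ∀ {N : ℕ} [NeZero N] (𝔯 : RateReading₁₃CoPH N),
        (∀ (F : T4Family) (θ : Stage13HParams F N) (hP : θ.Provisos₁₃CoPH F N), θ.Admissible F N →
          ∀ (g₀ : ℕ → ℝ) (os : List (ULoop F)),
          ∃ (n : ℕ) (_hn : 1 ≤ n) (M : ℕ → Fin d → ℕ) (_hMz : ∀ j μ, NeZero (M j μ))
            (_hM : ∀ j, ∃ mm : ℕ, ∀ μ, L * M j μ = 2 * L ^ mm)
            (C : Carriers) (_hsc : ∀ X, 1 ≤ C.scale X)
            (xA yA : (X : C.Dom) → Tor (fine (L ^ C.scale X) (fine L (M (C.scale X)))))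
            (xB yB : (X : C.Dom) → Tor (fine (L ^ n * L ^ C.scale X) (fine L (M (C.scale X)))))
            (_hx : ∀ X μ, (xA X μ).val = (xB X μ).val / L ^ n)
            (_hy : ∀ X μ, (yA X μ).val = (yB X μ).val / L ^ n)
            (_hd : ∀ X, C.d X ≤ tdistT (fine L (M (C.scale X)))
                (blockOf (L ^ C.scale X) (fine L (M (C.scale X))) (xA X))
                (blockOf (L ^ C.scale X) (fine L (M (C.scale X))) (yA X)))
            (EA : Functional C C.BgA) (EB : Functional C C.BgB)
            (_hEA : ∀ g U X, EA g U X =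
              (fun z => minimiser (L ^ C.scale X) (fine L (M (C.scale X))) (aK a L (C.scale X))
                  (((L ^ C.scale X : ℕ) : ℝ) ^ 2) m2 (Pi.single z 1) (xA X))
                ⬝ᵥ ((effLaplacian (L ^ C.scale X) (fine L (M (C.scale X))) (aK a L (C.scale X))
                        (((L ^ C.scale X : ℕ) : ℝ) ^ 2) m2
                      + (a * ((L : ℝ) ^ 2)⁻¹) • blockProj L (M (C.scale X)))⁻¹
                    *ᵥ fun w => minimiser (L ^ C.scale X) (fine L (M (C.scale X))) (aK a L (C.scale X))
                        (((L ^ C.scale X : ℕ) : ℝ) ^ 2) m2 (Pi.single w 1) (yA X)))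
            (_hEB : ∀ g U X, EB g U X =
              (fun z => minimiser (L ^ n * L ^ C.scale X) (fine L (M (C.scale X))) (aK a L (C.scale X + n))
                  (((L ^ n * L ^ C.scale X : ℕ) : ℝ) ^ 2) m2 (Pi.single z 1) (xB X))
                ⬝ᵥ ((effLaplacian (L ^ n * L ^ C.scale X) (fine L (M (C.scale X))) (aK a L (C.scale X + n))
                        (((L ^ n * L ^ C.scale X : ℕ) : ℝ) ^ 2) m2
                      + (a * ((L : ℝ) ^ 2)⁻¹) • blockProj L (M (C.scale X)))⁻¹
                    *ᵥ fun w => minimiser (L ^ n * L ^ C.scale X) (fine L (M (C.scale X))) (aK a L (C.scale X + n))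
                        (((L ^ n * L ^ C.scale X : ℕ) : ℝ) ^ 2) m2 (Pi.single w 1) (yB X)))
            (C₉ ω cr ρ : ℝ),
            (𝔯.lit F θ hP g₀ os).u3 =
              U3Objects₁₁.ofFixed C EA (fun _ => EB) ⟨κ, (L : ℝ) ^ (-(γ / 2)), C₅, C₉, ω, cr, ρ⟩) →
        S_N18 (RRec₁₃CoPH 𝔯) := by
  obtain ⟨κ, C₅, hκ, hC₅, H⟩ := ne5_kingModel_threeFactor_torus hd L hLp ha hm hγ0 hγ1
  refine ⟨κ, C₅, hκ, hC₅, ?_⟩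
  intro N _ 𝔯 hpin
  refine s_N18_rRec₁₃CoPH_of_ofFixed 𝔯 fun F θ hP hA g₀ os => ?_
  obtain ⟨n, hn, M, hMz, hM, C, hsc, xA, yA, xB, yB, hx, hy, hdd, EA, EB, hEA, hEB, C₉, ω, cr, ρ, hu⟩ :=
    hpin F θ hP hA g₀ os
  refine ⟨C, EA, fun _ => EB, ⟨κ, (L : ℝ) ^ (-(γ / 2)), C₅, C₉, ω, cr, ρ⟩, hu, fun b _ _ => ?_⟩
  exact H n hn M hM C hsc xA yA xB yB hx hy hdd EA EB hEA hEB (Window θ.γ)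

end King

/-! ## §4 The rung's letters PASS the displayed letter guards `U3Letters₁₁.Signs` -/

/-- **KING's LETTER BLOCK HAS THE SIGNS OF RECORD** (`γ > 0`, `L ≥ 2`): with decay `κ > 0`, rate `θ₅ = L^{−γ∕2} ∈ ]0, 1[`, constant
`C₅ ≥ 0`, any fading letters `0 ≤ C₉`, `0 ≤ ω < 1`, read-out constant `0 ≤ cr` and joint rate `max(L^{−γ∕2}, ω) ≤ ρ < 1` (e.g.
`C₉ = ω = cr = 0`, `ρ = L^{−γ∕2}`), the block `⟨κ, L^{−γ∕2}, C₅, C₉, ω, cr, ρ⟩` satisfies `U3Letters₁₁.Signs` — the plan's letter guards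
(nondegeneracy of `θ₅`, `ω`, `ρ`) are MET by the model; they do not separate it from Bałaban's outputs (only the W1 pin ∕ (D4) does).
[cite: King1986, Prop. 3.9 (3.73) p.665; Balaban1987RG1, (1.20)-(1.22) p.264] -/
theorem kingModel_letters_signs {L : ℕ} (hL : 2 ≤ L) {γ : ℝ} (hγ : 0 < γ) {κ C₅ C₉ ω cr ρ : ℝ} (hκ : 0 < κ) (hC₅ : 0 ≤ C₅)
    (hC₉ : 0 ≤ C₉) (hω0 : 0 ≤ ω) (hcr : 0 ≤ cr) (hθρ : (L : ℝ) ^ (-(γ / 2)) ≤ ρ) (hωρ : ω ≤ ρ) (hρ : ρ < 1) :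
    (⟨κ, (L : ℝ) ^ (-(γ / 2)), C₅, C₉, ω, cr, ρ⟩ : U3Letters₁₁).Signs where
  κ_nonneg := hκ.le
  θ₅_pos := kingTheta_pos (by omega) _
  θ₅_lt_one := kingTheta_lt_one hL (half_pos hγ)
  C₅_nonneg := hC₅
  C₉_nonneg := hC₉
  ω_nonneg := hω0
  ω_lt_one := lt_of_le_of_lt hωρ hρ
  cr_nonneg := hcr
  θ₅_le_ρ := hθρ
  ω_le_ρ := hωρ
  ρ_lt_one := hρ

/-- **THE MINIMAL HONEST BLOCK** `⟨κ, L^{−γ∕2}, C₅, 0, 0, 0, L^{−γ∕2}⟩` (`γ > 0`, `L ≥ 2`, `κ > 0`, `C₅ ≥ 0`) has the signs.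
[cite: King1986, Prop. 3.9 (3.73) p.665] -/
theorem kingModel_letters_signs_minimal {L : ℕ} (hL : 2 ≤ L) {γ : ℝ} (hγ : 0 < γ) {κ C₅ : ℝ} (hκ : 0 < κ) (hC₅ : 0 ≤ C₅) :
    (⟨κ, (L : ℝ) ^ (-(γ / 2)), C₅, 0, 0, 0, (L : ℝ) ^ (-(γ / 2))⟩ : U3Letters₁₁).Signs :=
  kingModel_letters_signs hL hγ hκ hC₅ le_rfl le_rfl le_rfl le_rfl (kingTheta_pos (by omega) _).le
    (kingTheta_lt_one hL (half_pos hγ))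

end Summit.QuantumFields.YangMills.BalabanUVNodes.N18KingModelRecordWindow

end
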